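import Mathlib.GroupTheory.Sylow
import Mathlib.Topology.Algebra.ClopenNhdofOne
import Mathlib.Topology.Algebra.OpenSubgroup
import Mathlib.Data.Nat.Factors
import Literature.AnabelianGeometry.AbsoluteAnabelian.FreeProcyclicStructure
import Literature.AnabelianGeometry.SemiGraphs.PSCFundamentalGroup
import HarnessLib

/-!
# The encoding lemma for "`≅ ℤ_l`": `IsFreeProSigmaCyclic {l}` versus "topologically monogenic and
# infinite" for closed subgroups of a pro-`l` group

Two typings of the phrase "a closed subgroup `A ⊆ Π` isomorphic to `ℤ_l`" coexist in the tree: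

* layer L4 ([AbsTopII] Prop. 1.3 (i) p. 11, abc-iut-L4-t6): the INTRINSIC predicate
  `AbsTopII.IsFreeProSigmaCyclic {l} A` — a dense cyclic subgroup, and the indices of open subgroups
  are exactly the `{l}`-integers (the powers of `l`); validated by the structure theorem
  `FreeProcyclicStructure` / `FreeProcyclicCharacterization` (`A ≃ₜ* ℤ_l`);
* layer L3 ([IUTchI] Rmk. 1.2.3 (iv) pp. 41–42, `SemiGraphs.PSCDatum.CuspidalEdgeLikeCharacterization`):
  "`A` is the closure of a cyclic subgroup `⟨a⟩` and `A` is infinite".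

For a CLOSED subgroup `A` of a profinite PRO-`l` group `Π` (`SemiGraphs.IsProSigma {l} Π`, the
PSC-fundamental group of [CombGC] Def. 1.1 (ii) with `Σ = {l}`) the two agree
(`AbsTopII.isFreeProSigmaCyclic_singleton_iff_of_isProSigma`).  This is the hypothesis `henc` of
abc-iut-w5-d062's `FundamentalExtension.CuspInertiaData.inertiaIffMaximalTotRam_ofPSC` (SUB-NODE B4
of the [AbsTopI] Lem. 4.5 sub-DAG, `plan/L4/SUBDAG-AbsTopI-Lem45.md`), discharged once and for all
here in profinite group theory.

Route (elementary, every step PROVED here; no definitions):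
* `isSigmaInteger_index_of_isOpen_of_isProSigma`: in a compact totally disconnected pro-`Σ` group, an open
  subgroup `H` of ANY subgroup `A` contains `U ∩ A` for some open normal `U ⊴ Π`, so
  `[A : H] ∣ [A : U ∩ A] ∣ [Π : U]`, a `Σ`-integer;
* `exists_isOpen_lt_index`: an infinite profinite group has open subgroups of arbitrarily large
  index (`N + 1` distinct elements are separated by an open normal subgroup);
* (⇐) for `A = closure ⟨a⟩` infinite: `A` is abelian, an open subgroup `H₀` of index `l^m ≥ l^k`
  exists, and Sylow's theorem in the finite group `A/H₀` gives a subgroup of index `l^k`, whose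
  preimage is open of index `l^k`;
* (⇒): a dense `⟨g⟩ ⊆ A` with `A` closed has `closure_Π ⟨g⟩ = A`; open subgroups of index `l^k`
  for every `k` force `A` infinite (`l` prime).

HONEST FRAMING: classical profinite group theory ([CombGC] Rmk. 1.1.3 "`Π_e ≅ Ẑ^Σ`" is the source
of the phrase); nothing here takes a side on [IUTchIII] Cor. 3.12; typed ≠ proved elsewhere.
-/

noncomputable section

open Topology

namespace Literature.AnabelianGeometry.AbsoluteAnabelian

open Literature.AnabelianGeometry.Anabelioids (IsSigmaInteger)
open Literature.AnabelianGeometry.SemiGraphs (IsProSigma)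

universe u

variable {P : Type u} [Group P] [TopologicalSpace P]

/-! ### Open subgroups of a subgroup of a pro-`Σ` group have `Σ`-integer index -/

/-- In a compact totally disconnected pro-`Σ` group `Π`, every open subgroup `H` of a subgroup `A`
(with the subspace topology) has index a `Σ`-integer: `H ⊇ U ∩ A` for an open normal `U ⊴ Π`, and
`[A : H] ∣ [A : U ∩ A] ∣ [Π : U]`. [cite: MochizukiCombGC2007, Def 1.1(ii) p.6] -/
theorem isSigmaInteger_index_of_isOpen_of_isProSigma [IsTopologicalGroup P] [CompactSpace P]
    [TotallyDisconnectedSpace P] {S : Set ℕ} (hP : IsProSigma S P) (A : Subgroup P)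
    (H : Subgroup A) (hH : IsOpen (H : Set A)) : IsSigmaInteger S H.index := by
  -- `H` is the trace on `A` of an open set `V ∋ 1` of `Π`
  obtain ⟨V, hV, hVH⟩ := isOpen_induced_iff.mp hH
  have h1V : (1 : P) ∈ V := by
    have h1 : (1 : A) ∈ ((↑) : A → P) ⁻¹' V := by rw [hVH]; exact H.one_mem
    exact h1
  obtain ⟨U, hU⟩ := ProfiniteGrp.exist_openNormalSubgroup_sub_open_nhds_of_one hV h1V
  -- `U ∩ A ≤ H`
  have hle : U.toSubgroup.subgroupOf A ≤ H := by
    intro y hy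
    rw [Subgroup.mem_subgroupOf] at hy
    have hyU : (y : P) ∈ (U : Set P) := hy
    have hyV : y ∈ ((↑) : A → P) ⁻¹' V := hU hyU
    rw [hVH] at hyV
    exact hyV
  haveI : Finite (P ⧸ U.toSubgroup) :=
    Subgroup.quotient_finite_of_isOpen U.toSubgroup U.toOpenSubgroup.isOpen
  haveI : U.toSubgroup.FiniteIndex := Subgroup.finiteIndex_of_finite_quotient
  have hdvd : H.index ∣ U.toSubgroup.index :=
    (Subgroup.index_dvd_of_le hle).trans (Subgroup.relIndex_dvd_index_of_normal U.toSubgroup A)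
  have hne : U.toSubgroup.index ≠ 0 := Subgroup.FiniteIndex.index_ne_zero
  refine ⟨Nat.pos_of_dvd_of_pos hdvd (Nat.pos_of_ne_zero hne), fun p hp hpd => ?_⟩
  exact hP.prime_mem U inferInstance p hp
    (by rw [← Subgroup.index_eq_card]; exact hpd.trans hdvd)

/-! ### An infinite profinite group has open subgroups of unbounded index -/

/-- An infinite compact Hausdorff totally disconnected group has, for every `N`, an open (normal)
subgroup of index `> N`: `N + 1` distinct elements `xᵢ` lie in distinct cosets of an open normal
subgroup avoiding the finitely many `xᵢ⁻¹ xⱼ`, `i ≠ j` (the open normal subgroups of a profinite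
group form a basis of neighbourhoods of `1` and separate points, [AbsTopI] §0 "Topological Groups").
[cite: MochizukiAbsTopI2012, §0 p.7] -/
theorem exists_isOpen_lt_index [IsTopologicalGroup P] [CompactSpace P] [T2Space P]
    [TotallyDisconnectedSpace P] [Infinite P] (N : ℕ) :
    ∃ H : Subgroup P, IsOpen (H : Set P) ∧ H.Normal ∧ N < H.index := by
  -- `N + 1` distinct elements
  let x : Fin (N + 1) ↪ P := Fin.valEmbedding.trans (Infinite.natEmbedding P)
  -- the open neighbourhood of `1` avoiding the quotients `(x i)⁻¹ * x j`, `i ≠ j`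
  let V : Set P := ⋂ i : Fin (N + 1), ⋂ j : Fin (N + 1), ⋂ (_ : i ≠ j), {(x i)⁻¹ * x j}ᶜ
  have hV : IsOpen V :=
    isOpen_iInter_of_finite fun i => isOpen_iInter_of_finite fun j =>
      isOpen_iInter_of_finite fun _ => isOpen_compl_singleton
  have h1V : (1 : P) ∈ V := by
    simp only [V, Set.mem_iInter, Set.mem_compl_iff, Set.mem_singleton_iff]
    intro i j hij h
    exact hij (x.injective (inv_mul_eq_one.mp h.symm))
  obtain ⟨U, hU⟩ := ProfiniteGrp.exist_openNormalSubgroup_sub_open_nhds_of_one hV h1V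
  refine ⟨U.toSubgroup, U.toOpenSubgroup.isOpen, inferInstance, ?_⟩
  -- `i ↦ x i · U` is injective
  have hinj : Function.Injective
      fun i : Fin (N + 1) => (QuotientGroup.mk (x i) : P ⧸ U.toSubgroup) := by
    intro i j hij
    by_contra hne
    have hmem : (x i)⁻¹ * x j ∈ U.toSubgroup := QuotientGroup.eq.mp hij
    have hmem' : (x i)⁻¹ * x j ∈ (U : Set P) := hmem
    have hV' := hU hmem'
    simp only [V, Set.mem_iInter, Set.mem_compl_iff, Set.mem_singleton_iff] at hV'
    exact hV' i j hne rfl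
  haveI : Finite (P ⧸ U.toSubgroup) :=
    Subgroup.quotient_finite_of_isOpen U.toSubgroup U.toOpenSubgroup.isOpen
  have hle := Nat.card_le_card_of_injective _ hinj
  rw [Nat.card_fin] at hle
  rw [Subgroup.index_eq_card]
  omega

namespace AbsTopII

variable [IsTopologicalGroup P]

/-! ### (⇒) a free pro-`Σ`-cyclic closed subgroup is the closure of a cyclic subgroup, and infinite -/

/-- If a CLOSED subgroup `A` is topologically generated by one element (in its subspace topology),
then `A` is the closure in `Π` of a cyclic subgroup of `Π`. [cite: MochizukiAbsTopII2013, Prop 1.3 (i) p.11] -/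
theorem IsFreeProSigmaCyclic.exists_topologicalClosure_zpowers_eq {S : Set ℕ} {A : Subgroup P}
    (hA : IsClosed (A : Set P)) (h : IsFreeProSigmaCyclic S ↥A) :
    ∃ a : P, (Subgroup.zpowers a).topologicalClosure = A := by
  obtain ⟨g, hg⟩ := h.exists_dense_zpowers
  refine ⟨(g : P), SetLike.ext' ?_⟩
  have hset : (Subgroup.zpowers (g : P) : Set P) =
      ((↑) : ↥A → P) '' (Subgroup.zpowers g : Set ↥A) := by
    have hmap := congrArg SetLike.coe (MonoidHom.map_zpowers A.subtype g)
    rw [Subgroup.coe_map] at hmap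
    exact hmap.symm
  have hce : Topology.IsClosedEmbedding ((↑) : ↥A → P) := hA.isClosedEmbedding_subtypeVal
  rw [Subgroup.topologicalClosure_coe, hset, hce.closure_image_eq, hg.closure_eq, Set.image_univ]
  exact Subtype.range_coe

/-- A free pro-`Σ`-cyclic group with some prime `p ∈ Σ` is infinite (it has an open subgroup of
index `pᵏ` for every `k`). [cite: MochizukiAbsTopII2013, Prop 1.3 (i) p.11] -/
theorem IsFreeProSigmaCyclic.infinite {S : Set ℕ} {G : Type u} [Group G] [TopologicalSpace G]
    (h : IsFreeProSigmaCyclic S G) {p : ℕ} (hp : p.Prime) (hpS : p ∈ S) : Infinite G := by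
  by_contra hfin
  rw [not_infinite_iff_finite] at hfin
  have hint : IsSigmaInteger S (p ^ Nat.card G) := by
    refine ⟨pow_pos hp.pos _, fun q hq hqd => ?_⟩
    rw [(Nat.prime_dvd_prime_iff_eq hq hp).mp (hq.dvd_of_dvd_pow hqd)]
    exact hpS
  obtain ⟨H, -, hidx⟩ := (h.isOpen_index_iff (p ^ Nat.card G)).mpr hint
  have hle : p ^ Nat.card G ≤ Nat.card G := by
    rw [← hidx]
    exact Nat.le_of_dvd Nat.card_pos H.index_dvd_card
  exact absurd hle (not_le.mpr (Nat.lt_pow_self hp.one_lt))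

/-- (⇒) of the encoding lemma, for `Σ = {l}`, `l` prime: a closed free pro-`l`-cyclic subgroup is the
closure of a cyclic subgroup and is infinite. [cite: Mochizuki2012, IUTchI Rmk 1.2.3(iv) pp.41-42] -/
theorem IsFreeProSigmaCyclic.topologicalClosure_zpowers_and_infinite {l : ℕ} (hl : l.Prime)
    {A : Subgroup P} (hA : IsClosed (A : Set P)) (h : IsFreeProSigmaCyclic {l} ↥A) :
    (∃ a : P, (Subgroup.zpowers a).topologicalClosure = A) ∧ (A : Set P).Infinite :=
  ⟨h.exists_topologicalClosure_zpowers_eq hA,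
    Set.infinite_coe_iff.mp (h.infinite hl (Set.mem_singleton l))⟩

/-! ### (⇐) an infinite topologically monogenic closed subgroup of a pro-`l` group is free pro-`l`-cyclic -/

/-- (⇐) of the encoding lemma: in a profinite pro-`l` group `Π` (`l` prime), a closed subgroup
`A = closure ⟨a⟩` which is infinite satisfies `IsFreeProSigmaCyclic {l}`: `⟨a⟩` is dense in `A`;
the open subgroups of `A` have index a power of `l` (`isSigmaInteger_index_of_isOpen_of_isProSigma`); and for every
`k` there is one of index exactly `lᵏ` — take an open `H₀` of index `lᵐ > lᵏ`
(`exists_isOpen_lt_index`), then the preimage of a subgroup of order `l^{m-k}` of the finite group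
`A/H₀` (Sylow; `A` is abelian). [cite: Mochizuki2012, IUTchI Rmk 1.2.3(iv) pp.41-42] -/
theorem isFreeProSigmaCyclic_singleton_of_topologicalClosure_zpowers_eq [CompactSpace P]
    [T2Space P] [TotallyDisconnectedSpace P] {l : ℕ} [hl : Fact l.Prime] (hP : IsProSigma {l} P)
    {A : Subgroup P} (hA : IsClosed (A : Set P)) {a : P}
    (ha : (Subgroup.zpowers a).topologicalClosure = A) (hinf : (A : Set P).Infinite) :
    IsFreeProSigmaCyclic {l} ↥A := by
  -- `a ∈ A`, and `⟨a⟩` is dense in `A`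
  have haA : a ∈ A := ha ▸ Subgroup.le_topologicalClosure _ (Subgroup.mem_zpowers a)
  set g : ↥A := ⟨a, haA⟩ with hg_def
  have hval : ((↑) : ↥A → P) '' (Subgroup.zpowers g : Set ↥A) = (Subgroup.zpowers a : Set P) := by
    have hmap := congrArg SetLike.coe (MonoidHom.map_zpowers A.subtype g)
    rw [Subgroup.coe_map] at hmap
    exact hmap
  have hg : Dense (Subgroup.zpowers g : Set ↥A) := by
    rw [dense_iff_closure_eq, Topology.IsEmbedding.subtypeVal.closure_eq_preimage_closure_image,
      hval, ← Subgroup.topologicalClosure_coe, ha]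
    exact Subtype.coe_preimage_self _
  -- instances on `A`
  haveI : CompactSpace ↥A := isCompact_iff_compactSpace.mp hA.isCompact
  haveI : Infinite ↥A := Set.infinite_coe_iff.mpr hinf
  -- `A` is commutative, so all of its subgroups are normal
  have hcomm : ∀ x y : ↥A, x * y = y * x := fun x y => mul_comm_of_dense_zpowers hg x y
  have hnormal : ∀ H : Subgroup ↥A, H.Normal := fun H =>
    ⟨fun x hx y => by rw [hcomm y x, mul_inv_cancel_right]; exact hx⟩
  refine ⟨⟨g, hg⟩, fun n => ⟨?_, ?_⟩⟩
  · -- indices of open subgroups are powers of `l`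
    rintro ⟨H, hH, rfl⟩
    exact isSigmaInteger_index_of_isOpen_of_isProSigma hP A H hH
  · -- every power of `l` occurs as an index
    intro hn
    -- `n = l ^ k`
    have hn_eq : n = l ^ n.primeFactorsList.length :=
      Nat.eq_prime_pow_of_unique_prime_dvd hn.1.ne'
        fun hd hdn => Set.mem_singleton_iff.mp (hn.2 _ hd hdn)
    set k := n.primeFactorsList.length with hk
    -- an open subgroup `H₀` of `A` of index `l ^ m > l ^ k`
    obtain ⟨H₀, hH₀, -, hlt⟩ := exists_isOpen_lt_index (P := ↥A) (l ^ k)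
    have h0 := isSigmaInteger_index_of_isOpen_of_isProSigma hP A H₀ hH₀
    have hm_eq : H₀.index = l ^ H₀.index.primeFactorsList.length :=
      Nat.eq_prime_pow_of_unique_prime_dvd h0.1.ne'
        fun hd hdn => Set.mem_singleton_iff.mp (h0.2 _ hd hdn)
    set m := H₀.index.primeFactorsList.length with hm
    have hkm : k ≤ m := by
      have hlt' : l ^ k < l ^ m := by rw [← hm_eq]; exact hlt
      exact ((Nat.pow_lt_pow_iff_right hl.out.one_lt).mp hlt').le
    -- Sylow in the finite quotient `A ⧸ H₀`
    haveI := hnormal H₀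
    haveI : Finite (↥A ⧸ H₀) := Subgroup.quotient_finite_of_isOpen H₀ hH₀
    have hcardQ : Nat.card (↥A ⧸ H₀) = l ^ m := by rw [← Subgroup.index_eq_card, hm_eq]
    obtain ⟨K, hK⟩ := Sylow.exists_subgroup_card_pow_prime l (n := m - k)
      (by rw [hcardQ]; exact Nat.pow_dvd_pow l (Nat.sub_le m k))
    have hKidx : K.index = l ^ k := by
      have h1 : Nat.card K * K.index = l ^ m := by rw [Subgroup.card_mul_index, hcardQ]
      rw [hK] at h1
      have h2 : l ^ (m - k) * l ^ k = l ^ m := by rw [← pow_add, Nat.sub_add_cancel hkm]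
      exact Nat.eq_of_mul_eq_mul_left (pow_pos hl.out.pos _) (h1.trans h2.symm)
    refine ⟨K.comap (QuotientGroup.mk' H₀), ?_, ?_⟩
    · refine Subgroup.isOpen_mono (H₁ := H₀) ?_ hH₀
      intro x hx
      rw [Subgroup.mem_comap, QuotientGroup.mk'_apply, (QuotientGroup.eq_one_iff x).mpr hx]
      exact K.one_mem
    · rw [K.index_comap_of_surjective (QuotientGroup.mk'_surjective H₀), hKidx]
      exact hn_eq.symm

/-! ### The encoding lemma -/

/-- **The encoding lemma for "`≅ ℤ_l`".**  For a CLOSED subgroup `A` of a compact Hausdorff totally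
disconnected pro-`l` group `Π` (`l` prime): `A` is free pro-`l`-cyclic in the intrinsic sense of
[AbsTopII] Prop. 1.3 (i) (`IsFreeProSigmaCyclic {l}`: dense cyclic subgroup, open subgroups of
exactly the `l`-power indices) iff `A` is the closure of a cyclic subgroup of `Π` and is infinite
(layer L3's reading of "isomorphic to `ℤ_l`" in [IUTchI] Rmk. 1.2.3 (iv)).  This is the hypothesis
`henc` of `FundamentalExtension.CuspInertiaData.inertiaIffMaximalTotRam_ofPSC`.
[cite: Mochizuki2012, IUTchI Rmk 1.2.3(iv) pp.41-42] [cite: MochizukiAbsTopII2013, Prop 1.3 (i) p.11] -/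
theorem isFreeProSigmaCyclic_singleton_iff_of_isProSigma [CompactSpace P] [T2Space P]
    [TotallyDisconnectedSpace P] {l : ℕ} [hl : Fact l.Prime] (hP : IsProSigma {l} P)
    {A : Subgroup P} (hA : IsClosed (A : Set P)) :
    IsFreeProSigmaCyclic {l} ↥A ↔
      (∃ a : P, (Subgroup.zpowers a).topologicalClosure = A) ∧ (A : Set P).Infinite :=
  ⟨fun h => h.topologicalClosure_zpowers_and_infinite hl.out hA,
    fun ⟨⟨_, ha⟩, hinf⟩ => isFreeProSigmaCyclic_singleton_of_topologicalClosure_zpowers_eq hP hA ha hinf⟩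

/-- The encoding lemma in the exact shape of the hypothesis `henc` of
`FundamentalExtension.CuspInertiaData.inertiaIffMaximalTotRam_ofPSC` (all closed subgroups at
once). [cite: Mochizuki2012, IUTchI Rmk 1.2.3(iv) pp.41-42] -/
theorem isFreeProSigmaCyclic_singleton_iff_forall_isClosed [CompactSpace P] [T2Space P]
    [TotallyDisconnectedSpace P] {l : ℕ} [Fact l.Prime] (hP : IsProSigma {l} P) :
    ∀ A : Subgroup P, IsClosed (A : Set P) →
      (IsFreeProSigmaCyclic {l} ↥A ↔
        (∃ a : P, (Subgroup.zpowers a).topologicalClosure = A) ∧ (A : Set P).Infinite) :=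
  fun _ hA => isFreeProSigmaCyclic_singleton_iff_of_isProSigma hP hA

end AbsTopII

end Literature.AnabelianGeometry.AbsoluteAnabelian

end
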